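import Summits.HubbardSuperconductivity.HubbardSuperconductivity.Theorems.AnisotropyChordTransferFibre3FinX3Eval

/-!
# Route `AnisotropyChord` / H0 rotor rung: FIN per-`L` GM₃ (X5), `L = 29` — rows `N₁` / D / side-condition cell facts, part `p27`

Kernel facts (`decide +kernel`) for cert cells 74, 75 of the per-`L` grid of `L = 29`: `xbnCellAny2` (row `N₁` on XB2 point wedges recomputed in the kernel, exporting the literal brackets `nt ⊇ T⁺ − 3λ₂` and `tb ⊇ T⁺·D`), `xdCellAnyN0` (row D, reads `nt`), `sdCellAnyZN` (side condition, reads `nt`); evaluators `…FinX3Eval` / `…FinX5Eval`; constants from the compiled design probe (x3probe/x3plan, margins c ×0.985, b ×1.03, aD ×1.03); assembled in `…FinX5GM3TwentyNine`.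
Prover seat `hubbard-h0-rotor-p3` g8; helper for piece A = stmt-HubbardSuperconductivity-23918 of rung 19089 (`--supports`, helper class).
WHAT THIS IS NOT: nothing here proves superconductivity in the Hubbard model (rotor TARGET as worded stays FALSE, g15 verdict); kernel facts for the FIN certificate of ONE conditional reduction.  Tree imports only; zero data; standard axioms.
-/

set_option linter.dupNamespace false
set_option autoImplicit false

namespace Summit.HubbardSuperconductivity.HubbardSuperconductivity.Theorems.AnisotropyChord.Transfer.Fibre3

namespace FinXD

open FinXB FinCell Hole2

set_option maxHeartbeats 4000000 in
/-- row `N₁` of cell 74 of `L = 29` (`c = 121/200`), exporting `nt`, `tb`. [folklore] -/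
theorem xn29_74 : xbnCellAny2 29 (49/50 : ℚ) 385656433220052 395297844050554 (121/200 : ℚ) ((-1315377799862 : ℤ), (2885102681712 : ℤ)) ((1155646860280096 : ℤ), (1188785696413572 : ℤ)) = true := by decide +kernel

set_option maxHeartbeats 4000000 in
/-- row D of cell 74 of `L = 29` (`aD = 83/1000`). [folklore] -/
theorem xd29_74 : xdCellAnyN0 29 (49/50 : ℚ) 385656433220052 395297844050554 (83/1000 : ℚ) ((-1315377799862 : ℤ), (2885102681712 : ℤ)) = true := by decide +kernel

set_option maxHeartbeats 4000000 in
/-- side condition of cell 74 of `L = 29` (`c, b = 62/100, aD`). [folklore] -/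
theorem sd29_74 : sdCellAnyZN 29 (49/50 : ℚ) 100 385656433220052 395297844050554 ((121/200 : ℚ), (62 : ℕ), (83/1000 : ℚ)) ((-1315377799862 : ℤ), (2885102681712 : ℤ)) = true := by decide +kernel

set_option maxHeartbeats 4000000 in
/-- row `N₁` of cell 75 of `L = 29` (`c = 121/200`), exporting `nt`, `tb`. [folklore] -/
theorem xn29_75 : xbnCellAny2 29 (49/50 : ℚ) 395297844050554 405180290151818 (121/200 : ℚ) ((-1254932877380 : ℤ), (2938257382083 : ℤ)) ((1184631361154579 : ℤ), (1218486365957240 : ℤ)) = true := by decide +kernel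

set_option maxHeartbeats 4000000 in
/-- row D of cell 75 of `L = 29` (`aD = 83/1000`). [folklore] -/
theorem xd29_75 : xdCellAnyN0 29 (49/50 : ℚ) 395297844050554 405180290151818 (83/1000 : ℚ) ((-1254932877380 : ℤ), (2938257382083 : ℤ)) = true := by decide +kernel

set_option maxHeartbeats 4000000 in
/-- side condition of cell 75 of `L = 29` (`c, b = 63/100, aD`). [folklore] -/
theorem sd29_75 : sdCellAnyZN 29 (49/50 : ℚ) 100 395297844050554 405180290151818 ((121/200 : ℚ), (63 : ℕ), (83/1000 : ℚ)) ((-1254932877380 : ℤ), (2938257382083 : ℤ)) = true := by decide +kernel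

end FinXD

end Summit.HubbardSuperconductivity.HubbardSuperconductivity.Theorems.AnisotropyChord.Transfer.Fibre3
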